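import Literature.NumberTheory.Sieve.RosserSieveTheoremOneHalfLt
import HarnessLib

/-!
# Rosser's sieve with a signed twist: Iwaniec's Theorem 1 for `½(a(n) − e(n))`

Topic `Literature/NumberTheory/Sieve`; a companion of `RosserSieveTheoremOneHalfLt.lean` (Iwaniec,
*Rosser's sieve*, Acta Arith. 36 (1980), Theorem 1 for `κ > 1/2`, PROVED there) and of
`SieveFrameworkFundamentalLemma.lean` (Rosser's weights `λ^±_d = μ(d)χ^±(d)`, the pointwise sieve
inequalities `BetaSieve.upper_sieve` / `BetaSieve.lower_sieve`).

The device formalised here is the standard one for sifting a *subsequence cut out by a sign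
condition* (a "parity oracle"): if `𝒜 = (a(n))` is a sifted sequence with the data of Theorem 1
(size `X`, multiplicative density `g` of dimension `Ω(κ, L)`, remainders `R_d`) and `e(n)` is any
real function with `|e(n)| ≤ a(n)` — typically `e(n) = a(n)λ(n)` for a completely multiplicative
sign `λ` — then the sequence `b(n) = ½(a(n) − e(n)) ≥ 0` (the part of `𝒜` where `λ = −1`) satisfies,
for Rosser's weights of level `y` and every squarefree sifting range `P`,

* `S(b, P) ≤ ∑_n b(n) θ⁺(n) = ½ ∑_d λ⁺_d 𝒜_d − ½ ∑_d λ⁺_d E_d`,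
* `S(b, P) ≥ ∑_n b(n) θ⁻(n) = ½ ∑_d λ⁻_d 𝒜_d − ½ ∑_d λ⁻_d E_d`,

`θ^±(n) = ∑_{d ∣ (n, P)} λ^±_d`, `E_d = ∑_{d ∣ n} e(n)` (pointwise: `b ≥ 0`, `θ⁻ ≤ 1_{(n,P)=1} ≤ θ⁺`),
and the first halves are the upper/lower sums of Theorem 1 for `𝒜` itself: `≤ X V(z)(F(s) + C(log y)^{-1/3}) + R`,
`≥ X V(z)(f(s) − C(log y)^{-1/3}) − R`, while `|∑_d λ^±_d E_d| ≤ ∑_{d < y, d ∣ P(z)} |E_d|` since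
`|λ^±_d| ≤ 1` and `λ^±_d = 0` for `d ≥ y`. So the twisted sequence is sifted with HALF the main term
of `𝒜`, the remainder of `𝒜`, and the extra "oracle" remainder `½ ∑_{d<y} |E_d|` — WITHOUT a size or
density of its own (this matters when `∑_n e(n)` is only known to be `o(X)` to a weak scale: taking
`b` as a sifted sequence with size `X' = ∑ b(n)` would cost `|∑ e| · ∑_{d<y} g(d)`). In the upper
bound one may moreover replace the unsigned half `½ a(n)` by any majorant sequence (`2b + e ≤ a`),
which is how an enlargement `ℬ ⊆ ℬ̃` of the support (Chen's switching) is combined with an oracle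
known only on `ℬ`.

Main results (all PROVED; no definitions, no named facts):

* `SieveSequence.abs_sum_ind_mul_le` — `|∑_{d∣P(z)} μ(d)χ^±(d) E_d| ≤ ∑_{d<y, d∣P(z)} |E_d|`;
* `SieveSequence.twisted_le_upperSum`, `SieveSequence.lowerSum_le_twisted` — the two displayed
  inequalities;
* `Iwaniec1980_twisted_upper_of_half_lt`, `Iwaniec1980_twisted_lower_of_half_lt` — Theorem 1 in the
  printed `y`-form for the twisted sequence, for every `κ > 1/2` (in particular the linear sieve).

References: H. Iwaniec, *Rosser's sieve*, Acta Arith. 36 (1980) 171–202, Theorem 1 and (3.4)–(3.7)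
[IwaniecActaArith1980]; G. Greaves, *Sieves in Number Theory* (2001), §3.1.2 Lemma 1 [Greaves2001];
the oracle device: J. Friedlander, H. Iwaniec, *Opera de Cribro*, AMS Colloquium Publ. 57 (2010),
§25 ("sieve with a twist"), and G. Harman, *Prime-Detecting Sieves* (2007), §3.
-/

open Finset
open scoped ArithmeticFunction.Moebius

noncomputable section

namespace Literature.NumberTheory.Sieve

open BetaSieve

namespace SieveSequence

variable (A : SieveSequence)

/-! ### Rearrangements and the level of Rosser's weights, for an arbitrary function `e` -/

/-- Rearranging a weighted sum of the congruence sums of an ARBITRARY function `e : ℕ → ℝ`: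
`∑_{d ∣ P} w(d) E_d(x) = ∑_{n ≤ x} e(n) ∑_{d ∣ (n, P)} w(d)`, `E_d(x) = ∑_{n ≤ x, d ∣ n} e(n)`
(the signed analogue of `SieveSequence.sum_weights_congrSum`; private plumbing). [folklore] -/
private theorem sum_weights_sum_filter_dvd (w : ℕ → ℝ) (e : ℕ → ℝ) {P : ℕ} (hP : P ≠ 0) (x : ℝ) :
    ∑ d ∈ P.divisors, w d * ∑ n ∈ (Ioc 0 ⌊x⌋₊).filter (d ∣ ·), e n =
      ∑ n ∈ Ioc 0 ⌊x⌋₊, e n * ∑ d ∈ (Nat.gcd n P).divisors, w d := by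
  simp only [Finset.sum_filter, Finset.mul_sum]
  rw [Finset.sum_comm]
  refine Finset.sum_congr rfl fun n _ => ?_
  rw [← Nat.divisors_filter_dvd_of_dvd hP (Nat.gcd_dvd_right n P), Finset.sum_filter]
  refine Finset.sum_congr rfl fun d hd => ?_
  have hdP : d ∣ P := Nat.dvd_of_mem_divisors hd
  by_cases h : d ∣ n
  · rw [if_pos h, if_pos (Nat.dvd_gcd h hdP), mul_comm]
  · rw [if_neg h, if_neg (fun h' => h ((Nat.dvd_gcd_iff.mp h').1)), mul_zero]

/-- **The level of Rosser's weights against an arbitrary function** (Iwaniec 1980, (3.7)): for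
`1 ≤ β`, `2 ≤ z ≤ y` and any `E : ℕ → ℝ`,
`|∑_{d ∣ P(z)} μ(d) χ^{par}(d) E(d)| ≤ ∑_{d < y, d ∣ P(z)} |E(d)|` (`|μχ| ≤ 1`, and `χ(d) = 1 ⇒ d < y`).
The case `E = R_d(x)` is `SieveSequence.abs_sum_ind_remainder_le`. [cite: IwaniecActaArith1980, (3.7)] -/
theorem abs_sum_ind_mul_le (par : ℕ) {β y z : ℝ} (hβ : 1 ≤ β) (hz : 2 ≤ z) (hzy : z ≤ y)
    (E : ℕ → ℝ) :
    |∑ d ∈ (primesProdBelow z).divisors, (μ d : ℝ) * ind par β y d * E d| ≤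
      ∑ d ∈ (Finset.range ⌈y⌉₊).filter (· ∣ primesProdBelow z), |E d| := by
  set P := primesProdBelow z with hP
  have hPsq : Squarefree P := squarefree_primesProdBelow z
  have hy1 : 1 < y := by linarith
  calc |∑ d ∈ P.divisors, (μ d : ℝ) * ind par β y d * E d|
      ≤ ∑ d ∈ P.divisors, |(μ d : ℝ) * ind par β y d * E d| := Finset.abs_sum_le_sum_abs _ _
    _ ≤ ∑ d ∈ P.divisors, (if (d : ℝ) < y then |E d| else 0) := by
        refine Finset.sum_le_sum fun d hd => ?_
        by_cases hpred : pred par β y d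
        · have hdd : d ∣ P := Nat.dvd_of_mem_divisors hd
          have hlt : (d : ℝ) < y := lt_level_of_pred_of_one_le hβ hy1 hzy
            (hPsq.squarefree_of_dvd hdd) (fun p hp => prime_lt_of_mem_primeFactors_of_dvd hdd hp)
            hpred
          rw [if_pos hlt, abs_mul, abs_mul]
          have hμ : |(μ d : ℝ)| ≤ 1 := by exact_mod_cast ArithmeticFunction.abs_moebius_le_one
          calc |(μ d : ℝ)| * |ind par β y d| * |E d| ≤ 1 * 1 * |E d| := by
                gcongr
                · exact abs_ind_le_one d
            _ = |E d| := by ring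
        · rw [ind_of_not_pred hpred, mul_zero, zero_mul, abs_zero]
          split_ifs
          · exact abs_nonneg _
          · exact le_rfl
    _ = ∑ d ∈ P.divisors.filter (fun d : ℕ => (d : ℝ) < y), |E d| := by
        rw [Finset.sum_filter]
    _ ≤ ∑ d ∈ (Finset.range ⌈y⌉₊).filter (· ∣ P), |E d| := by
        refine Finset.sum_le_sum_of_subset_of_nonneg (fun d hd => ?_) fun _ _ _ => abs_nonneg _
        rw [Finset.mem_filter] at hd ⊢
        rw [Finset.mem_range]
        exact ⟨Nat.lt_ceil.mpr hd.2, Nat.dvd_of_mem_divisors hd.1⟩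

/-! ### The twisted sieve inequalities (pointwise `θ⁻ ≤ 1_{(n,P)=1} ≤ θ⁺`, summed with weights `b ≥ 0`) -/

/-- **Twisted upper beta-sieve inequality.** For a sifted sequence `𝒜`, a squarefree `P`, Rosser's
upper weights `λ⁺_d = μ(d)χ⁺(d)` (any `β`, `D`) and real functions `b, e` with `0 ≤ b(n)` and
`2 b(n) + e(n) ≤ a(n)`:
`∑_{n ≤ x, (n,P)=1} b(n) ≤ ½ ∑_{d∣P} λ⁺_d 𝒜_d(x) − ½ ∑_{d∣P} λ⁺_d E_d(x)`, `E_d(x) = ∑_{n ≤ x, d∣n} e(n)`.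
Pointwise: `b(n)·1_{(n,P)=1} ≤ b(n) θ⁺(n) ≤ ½(a(n) − e(n)) θ⁺(n)` since `0 ≤ 1_{(n,P)=1} ≤ θ⁺(n)`
(`BetaSieve.upper_sieve`). [cite: Greaves2001, §3.1.2 Lemma 1] -/
theorem twisted_le_upperSum {β D : ℝ} (b e : ℕ → ℝ) (hb : ∀ n, 0 ≤ b n)
    (hbe : ∀ n, 2 * b n + e n ≤ A.a n) (x : ℝ) {P : ℕ} (hP : Squarefree P) :
    ∑ n ∈ (Ioc 0 ⌊x⌋₊).filter (fun n : ℕ => n.Coprime P), b n ≤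
      (1 / 2) * ∑ d ∈ P.divisors, ((μ d : ℝ) * ind 1 β D d) * A.congrSum d x -
        (1 / 2) * ∑ d ∈ P.divisors, ((μ d : ℝ) * ind 1 β D d) *
          ∑ n ∈ (Ioc 0 ⌊x⌋₊).filter (d ∣ ·), e n := by
  rw [sum_weights_congrSum A _ hP.ne_zero, sum_weights_sum_filter_dvd _ _ hP.ne_zero,
    Finset.mul_sum, Finset.mul_sum, ← Finset.sum_sub_distrib, Finset.sum_filter]
  refine Finset.sum_le_sum fun n _ => ?_
  set θ := ∑ d ∈ (Nat.gcd n P).divisors, (μ d : ℝ) * ind 1 β D d with hθ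
  have hθ1 : (if Nat.gcd n P = 1 then (1 : ℝ) else 0) ≤ θ :=
    upper_sieve (hP.squarefree_of_dvd (Nat.gcd_dvd_right n P))
  have hθ0 : 0 ≤ θ := le_trans (by split_ifs <;> norm_num) hθ1
  have h1 : (if n.Coprime P then b n else 0) ≤ b n * θ := by
    by_cases hc : n.Coprime P
    · rw [if_pos hc]
      rw [if_pos (Nat.Coprime.gcd_eq_one hc)] at hθ1
      nlinarith [hb n]
    · rw [if_neg hc]
      exact mul_nonneg (hb n) hθ0
  have h2 : b n * θ ≤ (1 / 2) * (A.a n * θ) - (1 / 2) * (e n * θ) := by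
    have := mul_le_mul_of_nonneg_right (hbe n) hθ0
    nlinarith
  exact h1.trans h2

/-- **Twisted lower beta-sieve inequality.** For a sifted sequence `𝒜`, a squarefree `P`, Rosser's
lower weights `λ⁻_d = μ(d)χ⁻(d)` and a real function `e` with `e(n) ≤ a(n)`:
`½ ∑_{d∣P} λ⁻_d 𝒜_d(x) − ½ ∑_{d∣P} λ⁻_d E_d(x) ≤ ∑_{n ≤ x, (n,P)=1} ½(a(n) − e(n))`.
Pointwise: `½(a − e) θ⁻ ≤ ½(a − e) 1_{(n,P)=1}` since `θ⁻ ≤ 1_{(n,P)=1}` (`BetaSieve.lower_sieve`) and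
`a − e ≥ 0`. [cite: Greaves2001, §3.1.2 Lemma 1] -/
theorem lowerSum_le_twisted {β D : ℝ} (e : ℕ → ℝ) (hae : ∀ n, e n ≤ A.a n) (x : ℝ) {P : ℕ}
    (hP : Squarefree P) :
    (1 / 2) * ∑ d ∈ P.divisors, ((μ d : ℝ) * ind 0 β D d) * A.congrSum d x -
        (1 / 2) * ∑ d ∈ P.divisors, ((μ d : ℝ) * ind 0 β D d) *
          ∑ n ∈ (Ioc 0 ⌊x⌋₊).filter (d ∣ ·), e n ≤
      ∑ n ∈ (Ioc 0 ⌊x⌋₊).filter (fun n : ℕ => n.Coprime P), (A.a n - e n) / 2 := by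
  rw [sum_weights_congrSum A _ hP.ne_zero, sum_weights_sum_filter_dvd _ _ hP.ne_zero,
    Finset.mul_sum, Finset.mul_sum, ← Finset.sum_sub_distrib, Finset.sum_filter]
  refine Finset.sum_le_sum fun n _ => ?_
  set θ := ∑ d ∈ (Nat.gcd n P).divisors, (μ d : ℝ) * ind 0 β D d with hθ
  have hθ1 : θ ≤ (if Nat.gcd n P = 1 then (1 : ℝ) else 0) :=
    lower_sieve (hP.squarefree_of_dvd (Nat.gcd_dvd_right n P))
  have hae' : 0 ≤ A.a n - e n := sub_nonneg.mpr (hae n)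
  have h2 : (1 / 2) * (A.a n * θ) - (1 / 2) * (e n * θ) = (A.a n - e n) / 2 * θ := by ring
  rw [h2]
  by_cases hc : n.Coprime P
  · rw [if_pos hc]
    rw [if_pos (Nat.Coprime.gcd_eq_one hc)] at hθ1
    nlinarith
  · rw [if_neg hc]
    rw [if_neg (fun h' => hc (Nat.coprime_iff_gcd_eq_one.mpr h'))] at hθ1
    exact mul_nonpos_of_nonneg_of_nonpos (by positivity) hθ1

end SieveSequence

/-! ### Iwaniec's Theorem 1 for the twisted sequence -/

/-- **Iwaniec's Theorem 1, upper bound, with a signed twist, for `κ > 1/2`.** There are greatest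
`β`-sieve data `B = (F, f, β, A)` of dimension `κ` such that for every `L` there is `C = C(κ, L)` with:
for every sifted sequence `𝒜` whose density has dimension `Ω(κ, L)`, all real functions `b, e` with
`0 ≤ b(n)`, `2b(n) + e(n) ≤ a(n)`, and all `x`, `2 ≤ z ≤ y`, `X(x) ≥ 0`,
`∑_{n ≤ x, (n, P(z)) = 1} b(n) ≤ ½ (X V(z) (F(s) + C (log y)^{-1/3}) + ∑_{d<y, d∣P(z)} |R_d(x)|)
  + ½ ∑_{d<y, d∣P(z)} |∑_{n ≤ x, d ∣ n} e(n)|`, `s = log y/log z`.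
Proof: `twisted_le_upperSum` with Rosser's weights of level `y`; the first half is bounded exactly as
in Theorem 1 (`indSum_congrSum_eq`, `mainSum_one_le_of_mainTerm_upper` fed by
`Iwaniec1980_mainTerm_upper_of_half_lt`, `abs_sum_ind_remainder_le`), the second by
`abs_sum_ind_mul_le`. [cite: IwaniecActaArith1980, Thm 1 (1.4), (3.4)–(3.7)] -/
theorem Iwaniec1980_twisted_upper_of_half_lt {κ : ℝ} (hκ : 1 / 2 < κ) :
    ∃ B : (ℝ → ℝ) × (ℝ → ℝ) × ℝ × ℝ, IsGreatestBetaSieveData κ B ∧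
    ∀ L : ℝ, ∃ C : ℝ, ∀ (A : SieveSequence), HasIwaniecDimension A.density κ L →
      ∀ b e : ℕ → ℝ, (∀ n, 0 ≤ b n) → (∀ n, 2 * b n + e n ≤ A.a n) →
      ∀ x y z : ℝ, 2 ≤ z → z ≤ y → 0 ≤ A.size x →
        ∑ n ∈ (Ioc 0 ⌊x⌋₊).filter (fun n : ℕ => n.Coprime (primesProdBelow z)), b n ≤
          (1 / 2) * (A.size x * A.densityProduct (primesProdBelow z) *
                (B.1 (Real.log y / Real.log z) + C * Real.log y ^ (-(1 / 3 : ℝ))) +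
              ∑ d ∈ (Finset.range ⌈y⌉₊).filter (· ∣ primesProdBelow z), |A.remainder d x|) +
            (1 / 2) * ∑ d ∈ (Finset.range ⌈y⌉₊).filter (· ∣ primesProdBelow z),
              |∑ n ∈ (Ioc 0 ⌊x⌋₊).filter (d ∣ ·), e n| := by
  obtain ⟨B, hB, hC⟩ := Iwaniec1980_mainTerm_upper_of_half_lt hκ
  refine ⟨B, hB, fun L => ?_⟩
  obtain ⟨C, hC⟩ := hC L
  obtain ⟨F, f, β, a⟩ := B
  have hsol : IsBetaSieveSolution κ F f β a := hB.1
  have hβ1 : 1 ≤ β := hsol.one_le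
  have hκ0 : 0 < κ := by linarith
  have hC' : ∀ g : ArithmeticFunction ℝ, g.IsMultiplicative → HasIwaniecDimension g κ L →
      ∀ y z : ℝ, 2 ≤ z → z ≤ y → z ^ (β - 1) ≤ y →
        BetaSieve.mainSum 1 g β y (primesProdBelow z) ≤
          BetaSieve.vprod g (primesProdBelow z) *
            (F (Real.log y / Real.log z) + C * Real.log y ^ (-(1 / 3 : ℝ))) := hC
  refine ⟨upperMainTermConst κ L C β a, fun A hdim b e hb hbe x y z hz hzy hX => ?_⟩
  have hPsq : Squarefree (primesProdBelow z) := squarefree_primesProdBelow z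
  change ∑ n ∈ (Ioc 0 ⌊x⌋₊).filter (fun n : ℕ => n.Coprime (primesProdBelow z)), b n ≤
    (1 / 2) * (A.size x * A.densityProduct (primesProdBelow z) *
        (F (Real.log y / Real.log z) + upperMainTermConst κ L C β a * Real.log y ^ (-(1 / 3 : ℝ))) +
      ∑ d ∈ (Finset.range ⌈y⌉₊).filter (· ∣ primesProdBelow z), |A.remainder d x|) +
    (1 / 2) * ∑ d ∈ (Finset.range ⌈y⌉₊).filter (· ∣ primesProdBelow z),
      |∑ n ∈ (Ioc 0 ⌊x⌋₊).filter (d ∣ ·), e n|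
  have hmain := mainSum_one_le_of_mainTerm_upper hκ0 hsol hC' A.density_mult hdim hz hzy
  change mainSum 1 A.density β y (primesProdBelow z) ≤ A.densityProduct (primesProdBelow z) *
      (F (Real.log y / Real.log z) + upperMainTermConst κ L C β a * Real.log y ^ (-(1 / 3 : ℝ)))
    at hmain
  have hsieve := A.twisted_le_upperSum (β := β) (D := y) b e hb hbe x hPsq
  rw [A.indSum_congrSum_eq] at hsieve
  have hrem := (abs_le.mp (A.abs_sum_ind_remainder_le 1 hβ1 hz hzy x)).2
  have hE := (abs_le.mp (SieveSequence.abs_sum_ind_mul_le 1 hβ1 hz hzy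
    (fun d => ∑ n ∈ (Ioc 0 ⌊x⌋₊).filter (d ∣ ·), e n))).1
  have h2 : A.size x * mainSum 1 A.density β y (primesProdBelow z) ≤
      A.size x * (A.densityProduct (primesProdBelow z) *
        (F (Real.log y / Real.log z) + upperMainTermConst κ L C β a * Real.log y ^ (-(1 / 3 : ℝ)))) :=
    mul_le_mul_of_nonneg_left hmain hX
  linarith

/-- **Iwaniec's Theorem 1, lower bound, with a signed twist, for `κ > 1/2`.** There are greatest
`β`-sieve data `B = (F, f, β, A)` of dimension `κ` such that for every `L` there is `C = C(κ, L)` with: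
for every sifted sequence `𝒜` whose density has dimension `Ω(κ, L)`, every real function `e` with
`e(n) ≤ a(n)`, and all `x`, `2 ≤ z ≤ y`, `X(x) ≥ 0`,
`½ (X V(z) (f(s) − C (log y)^{-1/3}) − ∑_{d<y, d∣P(z)} |R_d(x)|) − ½ ∑_{d<y, d∣P(z)} |∑_{n ≤ x, d∣n} e(n)|
  ≤ ∑_{n ≤ x, (n, P(z)) = 1} ½(a(n) − e(n))`, `s = log y/log z`.
Proof: `lowerSum_le_twisted` with Rosser's lower weights of level `y`; the first half as in Theorem 1
(`indSum_congrSum_eq`, the main-term lower bound `Iwaniec1980_mainTerm_lower_of_half_lt` when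
`z^β ≤ y`, else `f(s) = 0`; `abs_sum_ind_remainder_le`), the second by `abs_sum_ind_mul_le`.
[cite: IwaniecActaArith1980, Thm 1 (1.5), (3.4)–(3.7)] -/
theorem Iwaniec1980_twisted_lower_of_half_lt {κ : ℝ} (hκ : 1 / 2 < κ) :
    ∃ B : (ℝ → ℝ) × (ℝ → ℝ) × ℝ × ℝ, IsGreatestBetaSieveData κ B ∧
    ∀ L : ℝ, ∃ C : ℝ, ∀ (A : SieveSequence), HasIwaniecDimension A.density κ L →
      ∀ e : ℕ → ℝ, (∀ n, e n ≤ A.a n) →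
      ∀ x y z : ℝ, 2 ≤ z → z ≤ y → 0 ≤ A.size x →
        (1 / 2) * (A.size x * A.densityProduct (primesProdBelow z) *
                (B.2.1 (Real.log y / Real.log z) - C * Real.log y ^ (-(1 / 3 : ℝ))) -
              ∑ d ∈ (Finset.range ⌈y⌉₊).filter (· ∣ primesProdBelow z), |A.remainder d x|) -
            (1 / 2) * ∑ d ∈ (Finset.range ⌈y⌉₊).filter (· ∣ primesProdBelow z),
              |∑ n ∈ (Ioc 0 ⌊x⌋₊).filter (d ∣ ·), e n| ≤
          ∑ n ∈ (Ioc 0 ⌊x⌋₊).filter (fun n : ℕ => n.Coprime (primesProdBelow z)),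
            (A.a n - e n) / 2 := by
  obtain ⟨B, hB, hC⟩ := Iwaniec1980_mainTerm_lower_of_half_lt hκ
  refine ⟨B, hB, fun L => ?_⟩
  obtain ⟨C, hC⟩ := hC L
  refine ⟨max C 0, fun A hdim e hae x y z hz hzy hX => ?_⟩
  obtain ⟨F, f, β, a⟩ := B
  have hsol : IsBetaSieveSolution κ F f β a := hB.1
  have hβ1 : 1 ≤ β := hsol.one_le
  have hPsq : Squarefree (primesProdBelow z) := squarefree_primesProdBelow z
  have hV : 0 < A.densityProduct (primesProdBelow z) := hdim.densityProduct_pos z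
  have hz0 : 0 < z := by linarith
  have hz1 : 1 < z := by linarith
  have hy1 : 1 < y := by linarith
  have hlz : 0 < Real.log z := Real.log_pos hz1
  have hly : 0 < Real.log y := Real.log_pos hy1
  have hs0 : 0 < Real.log y / Real.log z := div_pos hly hlz
  have hℓ0 : 0 ≤ Real.log y ^ (-(1 / 3 : ℝ)) := Real.rpow_nonneg hly.le _
  set R := ∑ d ∈ (Finset.range ⌈y⌉₊).filter (· ∣ primesProdBelow z), |A.remainder d x| with hR
  set RE := ∑ d ∈ (Finset.range ⌈y⌉₊).filter (· ∣ primesProdBelow z),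
    |∑ n ∈ (Ioc 0 ⌊x⌋₊).filter (d ∣ ·), e n| with hRE
  have hR0 : 0 ≤ R := Finset.sum_nonneg fun _ _ => abs_nonneg _
  have hRE0 : 0 ≤ RE := Finset.sum_nonneg fun _ _ => abs_nonneg _
  have hS0 : 0 ≤ ∑ n ∈ (Ioc 0 ⌊x⌋₊).filter (fun n : ℕ => n.Coprime (primesProdBelow z)),
      (A.a n - e n) / 2 :=
    Finset.sum_nonneg fun n _ => by linarith [hae n]
  have hM0 : 0 ≤ max C 0 * Real.log y ^ (-(1 / 3 : ℝ)) := mul_nonneg (le_max_right C 0) hℓ0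
  have hXV : 0 ≤ A.size x * A.densityProduct (primesProdBelow z) := mul_nonneg hX hV.le
  change (1 / 2) * (A.size x * A.densityProduct (primesProdBelow z) *
      (f (Real.log y / Real.log z) - max C 0 * Real.log y ^ (-(1 / 3 : ℝ))) - R) - (1 / 2) * RE ≤
    ∑ n ∈ (Ioc 0 ⌊x⌋₊).filter (fun n : ℕ => n.Coprime (primesProdBelow z)), (A.a n - e n) / 2
  -- the sieve inequality
  have hsieve := A.lowerSum_le_twisted (β := β) (D := y) e hae x hPsq
  rw [A.indSum_congrSum_eq] at hsieve
  have hrem := (abs_le.mp (A.abs_sum_ind_remainder_le 0 hβ1 hz hzy x)).1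
  have hE := (abs_le.mp (SieveSequence.abs_sum_ind_mul_le 0 hβ1 hz hzy
    (fun d => ∑ n ∈ (Ioc 0 ⌊x⌋₊).filter (d ∣ ·), e n))).2
  rw [← hR] at hrem
  rw [← hRE] at hE
  by_cases hcase : z ^ β ≤ y
  · -- main case `s ≥ β`
    have hmain := hC A.density A.density_mult hdim y z hz hcase
    change A.densityProduct (primesProdBelow z) *
        (f (Real.log y / Real.log z) - C * Real.log y ^ (-(1 / 3 : ℝ))) ≤
      mainSum 0 A.density β y (primesProdBelow z) at hmain
    have h1 : A.size x * A.densityProduct (primesProdBelow z) *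
        (f (Real.log y / Real.log z) - max C 0 * Real.log y ^ (-(1 / 3 : ℝ))) ≤
        A.size x * (A.densityProduct (primesProdBelow z) *
          (f (Real.log y / Real.log z) - C * Real.log y ^ (-(1 / 3 : ℝ)))) := by
      rw [mul_assoc]
      refine mul_le_mul_of_nonneg_left (mul_le_mul_of_nonneg_left ?_ hV.le) hX
      have := mul_le_mul_of_nonneg_right (le_max_left C 0) hℓ0
      linarith
    have h2 : A.size x * (A.densityProduct (primesProdBelow z) *
          (f (Real.log y / Real.log z) - C * Real.log y ^ (-(1 / 3 : ℝ)))) ≤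
        A.size x * mainSum 0 A.density β y (primesProdBelow z) :=
      mul_le_mul_of_nonneg_left hmain hX
    linarith
  · -- trivial case `s < β`: `f(s) = 0`
    push Not at hcase
    have hsβ : Real.log y / Real.log z ≤ β := by
      rw [div_le_iff₀ hlz]
      have := Real.log_lt_log (by linarith) hcase
      rw [Real.log_rpow hz0] at this
      linarith
    have hfs : f (Real.log y / Real.log z) = 0 := hsol.lower_eq _ ⟨hs0, hsβ⟩
    rw [hfs, zero_sub]
    have := mul_nonneg hXV hM0
    nlinarith

end Literature.NumberTheory.Sieve
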